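import Mathlib
import Summits.Ventures.HodgeRepro.Tier4.Line1.RTFSetting
import Summits.Ventures.HodgeRepro.Tier4.Line1.RtfGeometric
import Summits.Ventures.HodgeRepro.Tier4.Line4.KernelL1
import Summits.Ventures.HodgeRepro.Tier4.Line4.L1Class
import Summits.Ventures.HodgeRepro.Tier4.Line4.RtfGeometricL1

/-!
# Tier4/Line4/TailBound — the tail of the geometric side is bounded by the Poincaré series off `o₀`

Blind re-derivation cell `pub-hodge-repro`, Tier 4 «prove the step» (README §9–§10), seat t4-L4-p2 (prover, LINE L4,
gen 4; cut C-L4-TAILBOUND, S15042, the rational-point assembly (C) of t4-x2 S15033 / lead (R-26) S15038).  Tree path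
`lean/Summits/Ventures/HodgeRepro/Tier4/Line4/TailBound.lean`.  Mathlib-level; no literature; no `def`.

For a continuous `f` with the uniform Poincaré bound (`L1Class.PoincareSummable S f`, display (8)) and a distinguished
double coset `o₀`, the sum of the orbital terms over all OTHER double cosets is controlled by the rational points OUTSIDE
`o₀` alone:
  `‖∑'_{o ≠ o₀} O_o(f)‖ ≤ μ_T(D_T) · μ_{T′}(D_{T′}) · sup_{t ∈ cl D_T, t' ∈ cl D_{T′}} ∑_{γ ∉ o₀} ‖f(t⁻¹ γ t')‖`.
No orbit count, no orbit size, no properness enters: `‖O_o(f)‖ ≤ ∫_{D_T}∫_{D_{T′}} ‖K_f^o‖ ≤ ∫∫ ∑_{γ ∈ o} ‖f‖`, and for a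
finite set `s` of double cosets `≠ o₀` the fibre sums regroup, `∑_{o ∈ s} ∑_{γ ∈ o} ‖f(t⁻¹ γ t')‖ ≤ ∑_{γ ∉ o₀} ‖f(t⁻¹ γ t')‖`
(`HasSum.tsum_fiberwise` on the rational points outside `o₀`, `Summable.sum_le_tsum`), so the partial sums of
`o ↦ ‖O_o(f)‖` over `o ≠ o₀` are bounded by `M · μ_{T′}(D_{T′}) · μ_T(D_T)` and `Real.tsum_le_of_sum_le` /
`norm_tsum_le_tsum_norm` finish.  The consumer is the tail estimate of C-L4-TAIL: with the point form of the sparsity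
(S1), the decay `HasDecay3` and the sublevel count `SublevelCount`, x2's threshold layer-cake bounds the `sup` by a quantity
`→ 0` in the level, and L1-p4's `J_ne_zero_of_orbital_tail` takes `‖tail‖ < ‖O_{o₀}‖`.

Nothing here says anything about the status of the Hodge conjecture for CM abelian varieties, which is NOT proved
(HC_CM is NOT proved by anyone in this repository).
-/

set_option autoImplicit false

noncomputable section

namespace Summit.Ventures.HodgeRepro.Tier4.Line4

open MeasureTheory Topology Filter Set Summit.Ventures.HodgeRepro.Tier4 Summit.Ventures.HodgeRepro.Tier4.Line1
  Summit.Ventures.HodgeRepro.Tier4.Line1.RTF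

variable {G : Type} [Group G] [TopologicalSpace G] [IsTopologicalGroup G] [MeasurableSpace G] [BorelSpace G]
  (S : Setting G)

section Fibres

omit [IsTopologicalGroup G] [BorelSpace G] in
/-- **The fibre sums over finitely many double cosets `≠ o₀` are bounded by the Poincaré series off `o₀`**:
`∑_{o ∈ s} ∑_{γ ∈ o} ‖f(x⁻¹ γ y)‖ ≤ ∑_{γ ∉ o₀} ‖f(x⁻¹ γ y)‖`. -/
theorem sum_tsum_norm_fiber_ne_le {f : G → ℂ} {x y : G} (hs : Summable (fun γ : S.Gk => ‖f (x⁻¹ * γ * y)‖))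
    (o₀ : S.Orbit) (s : Finset {o : S.Orbit // o ≠ o₀}) :
    ∑ o ∈ s, ∑' γ : {γ : S.Gk // S.orbitOf γ = o.1}, ‖f (x⁻¹ * γ.1 * y)‖ ≤
      ∑' γ : {γ : S.Gk // S.orbitOf γ ≠ o₀}, ‖f (x⁻¹ * γ.1 * y)‖ := by
  have hT : Summable (fun γ : {γ : S.Gk // S.orbitOf γ ≠ o₀} => ‖f (x⁻¹ * γ.1 * y)‖) := hs.subtype _
  have h := hT.hasSum.tsum_fiberwise
    (fun γ : {γ : S.Gk // S.orbitOf γ ≠ o₀} => (⟨S.orbitOf γ.1, γ.2⟩ : {o : S.Orbit // o ≠ o₀}))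
  have hle := h.summable.sum_le_tsum s (fun o _ => tsum_nonneg fun _ => norm_nonneg _)
  rw [h.tsum_eq] at hle
  refine le_trans (le_of_eq ?_) hle
  refine Finset.sum_congr rfl fun o _ => ?_
  -- the fibre of `o` inside the rational points outside `o₀` is the fibre of `o`
  let e : ((fun γ : {γ : S.Gk // S.orbitOf γ ≠ o₀} => (⟨S.orbitOf γ.1, γ.2⟩ : {o : S.Orbit // o ≠ o₀})) ⁻¹' {o}) ≃
      {γ : S.Gk // S.orbitOf γ = o.1} :=
    { toFun := fun γ => ⟨γ.1.1, congrArg Subtype.val (Set.mem_singleton_iff.mp γ.2)⟩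
      invFun := fun γ => ⟨⟨γ.1, by rw [γ.2]; exact o.2⟩, Set.mem_singleton_iff.mpr (Subtype.ext γ.2)⟩
      left_inv := fun _ => rfl
      right_inv := fun _ => rfl }
  exact (e.tsum_eq (fun γ : {γ : S.Gk // S.orbitOf γ = o.1} => ‖f (x⁻¹ * γ.1 * y)‖)).symm

end Fibres

section Tail

variable [SecondCountableTopology G]

omit [IsTopologicalGroup G] [BorelSpace G] [SecondCountableTopology G] in
/-- Partial sums of the partial-kernel integrands over double cosets `≠ o₀`, bounded by the Poincaré series off `o₀`. -/
theorem sum_norm_partialKernel_mul_ne_le {f : G → ℂ} (hP : L1Class.PoincareSummable S f)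
    {χ : S.T → ℂ} (hu : ∀ a, ‖χ a‖ = 1) {χ' : S.T' → ℂ} (hu' : ∀ a, ‖χ' a‖ = 1) (o₀ : S.Orbit) {M : ℝ}
    (hM : ∀ t ∈ closure S.DT, ∀ t' ∈ closure S.DT',
      ∑' γ : {γ : S.Gk // S.orbitOf γ ≠ o₀}, ‖f ((t : G)⁻¹ * γ.1 * t')‖ ≤ M)
    (s : Finset {o : S.Orbit // o ≠ o₀}) {t : S.T} (ht : t ∈ closure S.DT) {t' : S.T'}
    (ht' : t' ∈ closure S.DT') :
    ∑ o ∈ s, ‖S.partialKernel o.1 f t t' * χ t * starRingEnd ℂ (χ' t')‖ ≤ M := by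
  have hs := summable_norm_of_poincareUniform S hP
  calc ∑ o ∈ s, ‖S.partialKernel o.1 f t t' * χ t * starRingEnd ℂ (χ' t')‖
      = ∑ o ∈ s, ‖S.partialKernel o.1 f t t'‖ := by
        refine Finset.sum_congr rfl fun o _ => ?_
        rw [norm_mul, norm_mul, Complex.norm_conj, hu, hu', mul_one, mul_one]
    _ ≤ ∑ o ∈ s, ∑' γ : {γ : S.Gk // S.orbitOf γ = o.1}, ‖f ((t : G)⁻¹ * γ.1 * t')‖ :=
        Finset.sum_le_sum fun o _ => norm_partialKernel_le_tsum_fiber S hs o.1 t t'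
    _ ≤ ∑' γ : {γ : S.Gk // S.orbitOf γ ≠ o₀}, ‖f ((t : G)⁻¹ * γ.1 * t')‖ :=
        sum_tsum_norm_fiber_ne_le S (hs t t') o₀ s
    _ ≤ M := hM t ht t' ht'

/-- **THE TAIL BOUND**: `‖∑'_{o ≠ o₀} O_o(f)‖ ≤ M · μ_{T′}(D_{T′}) · μ_T(D_T)` whenever the Poincaré series off `o₀` is
bounded by `M` on `closure D_T × closure D_{T′}`; the family of orbital terms off `o₀` is summable in norm. -/
theorem norm_tsum_orbital_ne_le {χ : S.T → ℂ} {χ' : S.T' → ℂ} (hχ : S.IsCharacter χ) (hχ' : S.IsCharacter' χ')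
    {f : G → ℂ} (hf : Continuous f) (hP : L1Class.PoincareSummable S f) (o₀ : S.Orbit) {M : ℝ}
    (hM : ∀ t ∈ closure S.DT, ∀ t' ∈ closure S.DT',
      ∑' γ : {γ : S.Gk // S.orbitOf γ ≠ o₀}, ‖f ((t : G)⁻¹ * γ.1 * t')‖ ≤ M) :
    Summable (fun o : {o : S.Orbit // o ≠ o₀} => ‖S.orbital χ χ' o.1 f‖) ∧
      ‖∑' o : {o : S.Orbit // o ≠ o₀}, S.orbital χ χ' o.1 f‖ ≤ M * S.μT'.real S.DT' * S.μT.real S.DT := by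
  haveI : Countable S.Gk := countable_Gk S
  have hint : ∀ o : S.Orbit, Integrable (fun t : S.T =>
      ∫ t' in S.DT', S.partialKernel o f t t' * χ t * starRingEnd ℂ (χ' t') ∂S.μT') (S.μT.restrict S.DT) :=
    fun o => integrableOn_integral_partialKernel_mul_DT S hf hP o hχ.cont hχ.unit hχ'.cont hχ'.unit
  -- the partial sums of `‖O_o(f)‖` over `o ≠ o₀`
  have key : ∀ s : Finset {o : S.Orbit // o ≠ o₀},
      ∑ o ∈ s, ‖S.orbital χ χ' o.1 f‖ ≤ M * S.μT'.real S.DT' * S.μT.real S.DT := by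
    intro s
    calc ∑ o ∈ s, ‖S.orbital χ χ' o.1 f‖
        ≤ ∑ o ∈ s, ∫ t in S.DT,
            ‖∫ t' in S.DT', S.partialKernel o.1 f t t' * χ t * starRingEnd ℂ (χ' t') ∂S.μT'‖ ∂S.μT :=
          Finset.sum_le_sum fun o _ => norm_integral_le_integral_norm _
      _ = ∫ t in S.DT, ∑ o ∈ s,
            ‖∫ t' in S.DT', S.partialKernel o.1 f t t' * χ t * starRingEnd ℂ (χ' t') ∂S.μT'‖ ∂S.μT :=
          (integral_finsetSum _ fun o _ => (hint o.1).norm).symm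
      _ ≤ M * S.μT'.real S.DT' * S.μT.real S.DT := by
          refine (Real.le_norm_self _).trans (norm_setIntegral_le_of_norm_le_const (measure_DT_lt_top S)
            fun t ht => ?_)
          rw [Real.norm_of_nonneg (Finset.sum_nonneg fun o _ => norm_nonneg _)]
          have hintT' : ∀ o : S.Orbit, Integrable
              (fun t' : S.T' => S.partialKernel o f t t' * χ t * starRingEnd ℂ (χ' t')) (S.μT'.restrict S.DT') :=
            fun o => integrableOn_partialKernel_mul_DT' S hf hP o χ hχ'.cont hχ'.unit (subset_closure ht)
          calc ∑ o ∈ s, ‖∫ t' in S.DT', S.partialKernel o.1 f t t' * χ t * starRingEnd ℂ (χ' t') ∂S.μT'‖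
              ≤ ∑ o ∈ s, ∫ t' in S.DT', ‖S.partialKernel o.1 f t t' * χ t * starRingEnd ℂ (χ' t')‖ ∂S.μT' :=
                Finset.sum_le_sum fun o _ => norm_integral_le_integral_norm _
            _ = ∫ t' in S.DT', ∑ o ∈ s, ‖S.partialKernel o.1 f t t' * χ t * starRingEnd ℂ (χ' t')‖ ∂S.μT' :=
                (integral_finsetSum _ fun o _ => (hintT' o.1).norm).symm
            _ ≤ M * S.μT'.real S.DT' := by
                refine (Real.le_norm_self _).trans (norm_setIntegral_le_of_norm_le_const
                  (measure_DT'_lt_top S) fun t' ht' => ?_)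
                rw [Real.norm_of_nonneg (Finset.sum_nonneg fun o _ => norm_nonneg _)]
                exact sum_norm_partialKernel_mul_ne_le S hP hχ.unit hχ'.unit o₀ hM s (subset_closure ht)
                  (subset_closure ht')
  have hsum : Summable (fun o : {o : S.Orbit // o ≠ o₀} => ‖S.orbital χ χ' o.1 f‖) :=
    summable_of_sum_le (fun _ => norm_nonneg _) key
  exact ⟨hsum, (norm_tsum_le_tsum_norm hsum).trans (Real.tsum_le_of_sum_le (fun _ => norm_nonneg _) key)⟩

end Tail

/-! ## 2. The same with an EXCEPTION SET `E` of double cosets (lead (R-27) S15050: the stable fibre `I⁻¹(I(o₀))` — the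
tail off a FINITE set of double cosets, and `J = ∑_{o ∈ E} O_o + ∑'_{o ∉ E} O_o`) -/

section Fibre

variable [SecondCountableTopology G]

omit [IsTopologicalGroup G] [BorelSpace G] [SecondCountableTopology G] in
/-- The fibre sums over finitely many double cosets outside `E` are bounded by the Poincaré series over the rational
points outside `E`. -/
theorem sum_tsum_norm_fiber_compl_le {f : G → ℂ} {x y : G} (hs : Summable (fun γ : S.Gk => ‖f (x⁻¹ * γ * y)‖))
    (E : Set S.Orbit) (s : Finset ↑Eᶜ) :
    ∑ o ∈ s, ∑' γ : {γ : S.Gk // S.orbitOf γ = o.1}, ‖f (x⁻¹ * γ.1 * y)‖ ≤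
      ∑' γ : {γ : S.Gk // S.orbitOf γ ∈ Eᶜ}, ‖f (x⁻¹ * γ.1 * y)‖ := by
  have hT : Summable (fun γ : {γ : S.Gk // S.orbitOf γ ∈ Eᶜ} => ‖f (x⁻¹ * γ.1 * y)‖) := hs.subtype _
  have h := hT.hasSum.tsum_fiberwise
    (fun γ : {γ : S.Gk // S.orbitOf γ ∈ Eᶜ} => (⟨S.orbitOf γ.1, γ.2⟩ : ↑Eᶜ))
  have hle := h.summable.sum_le_tsum s (fun o _ => tsum_nonneg fun _ => norm_nonneg _)
  rw [h.tsum_eq] at hle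
  refine le_trans (le_of_eq ?_) hle
  refine Finset.sum_congr rfl fun o _ => ?_
  let e : ((fun γ : {γ : S.Gk // S.orbitOf γ ∈ Eᶜ} => (⟨S.orbitOf γ.1, γ.2⟩ : ↑Eᶜ)) ⁻¹' {o}) ≃
      {γ : S.Gk // S.orbitOf γ = o.1} :=
    { toFun := fun γ => ⟨γ.1.1, congrArg Subtype.val (Set.mem_singleton_iff.mp γ.2)⟩
      invFun := fun γ => ⟨⟨γ.1, by rw [γ.2]; exact o.2⟩, Set.mem_singleton_iff.mpr (Subtype.ext γ.2)⟩
      left_inv := fun _ => rfl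
      right_inv := fun _ => rfl }
  exact (e.tsum_eq (fun γ : {γ : S.Gk // S.orbitOf γ = o.1} => ‖f (x⁻¹ * γ.1 * y)‖)).symm

omit [IsTopologicalGroup G] [BorelSpace G] [SecondCountableTopology G] in
/-- Partial sums of the partial-kernel integrands over double cosets outside `E`, bounded by the Poincaré series over
the rational points outside `E`. -/
theorem sum_norm_partialKernel_mul_compl_le {f : G → ℂ} (hP : L1Class.PoincareSummable S f)
    {χ : S.T → ℂ} (hu : ∀ a, ‖χ a‖ = 1) {χ' : S.T' → ℂ} (hu' : ∀ a, ‖χ' a‖ = 1) (E : Set S.Orbit) {M : ℝ}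
    (hM : ∀ t ∈ closure S.DT, ∀ t' ∈ closure S.DT',
      ∑' γ : {γ : S.Gk // S.orbitOf γ ∈ Eᶜ}, ‖f ((t : G)⁻¹ * γ.1 * t')‖ ≤ M)
    (s : Finset ↑Eᶜ) {t : S.T} (ht : t ∈ closure S.DT) {t' : S.T'} (ht' : t' ∈ closure S.DT') :
    ∑ o ∈ s, ‖S.partialKernel o.1 f t t' * χ t * starRingEnd ℂ (χ' t')‖ ≤ M := by
  have hs := summable_norm_of_poincareUniform S hP
  calc ∑ o ∈ s, ‖S.partialKernel o.1 f t t' * χ t * starRingEnd ℂ (χ' t')‖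
      = ∑ o ∈ s, ‖S.partialKernel o.1 f t t'‖ := by
        refine Finset.sum_congr rfl fun o _ => ?_
        rw [norm_mul, norm_mul, Complex.norm_conj, hu, hu', mul_one, mul_one]
    _ ≤ ∑ o ∈ s, ∑' γ : {γ : S.Gk // S.orbitOf γ = o.1}, ‖f ((t : G)⁻¹ * γ.1 * t')‖ :=
        Finset.sum_le_sum fun o _ => norm_partialKernel_le_tsum_fiber S hs o.1 t t'
    _ ≤ ∑' γ : {γ : S.Gk // S.orbitOf γ ∈ Eᶜ}, ‖f ((t : G)⁻¹ * γ.1 * t')‖ :=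
        sum_tsum_norm_fiber_compl_le S (hs t t') E s
    _ ≤ M := hM t ht t' ht'

/-- **THE TAIL BOUND OFF AN EXCEPTION SET**: `‖∑'_{o ∉ E} O_o(f)‖ ≤ M · μ_{T′}(D_{T′}) · μ_T(D_T)` whenever the Poincaré
series over the rational points outside `E` is bounded by `M` on `closure D_T × closure D_{T′}`. -/
theorem norm_tsum_orbital_compl_le {χ : S.T → ℂ} {χ' : S.T' → ℂ} (hχ : S.IsCharacter χ) (hχ' : S.IsCharacter' χ')
    {f : G → ℂ} (hf : Continuous f) (hP : L1Class.PoincareSummable S f) (E : Set S.Orbit) {M : ℝ}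
    (hM : ∀ t ∈ closure S.DT, ∀ t' ∈ closure S.DT',
      ∑' γ : {γ : S.Gk // S.orbitOf γ ∈ Eᶜ}, ‖f ((t : G)⁻¹ * γ.1 * t')‖ ≤ M) :
    Summable (fun o : ↑Eᶜ => ‖S.orbital χ χ' o.1 f‖) ∧
      ‖∑' o : ↑Eᶜ, S.orbital χ χ' o.1 f‖ ≤ M * S.μT'.real S.DT' * S.μT.real S.DT := by
  haveI : Countable S.Gk := countable_Gk S
  have hint : ∀ o : S.Orbit, Integrable (fun t : S.T =>
      ∫ t' in S.DT', S.partialKernel o f t t' * χ t * starRingEnd ℂ (χ' t') ∂S.μT') (S.μT.restrict S.DT) :=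
    fun o => integrableOn_integral_partialKernel_mul_DT S hf hP o hχ.cont hχ.unit hχ'.cont hχ'.unit
  have key : ∀ s : Finset ↑Eᶜ,
      ∑ o ∈ s, ‖S.orbital χ χ' o.1 f‖ ≤ M * S.μT'.real S.DT' * S.μT.real S.DT := by
    intro s
    calc ∑ o ∈ s, ‖S.orbital χ χ' o.1 f‖
        ≤ ∑ o ∈ s, ∫ t in S.DT,
            ‖∫ t' in S.DT', S.partialKernel o.1 f t t' * χ t * starRingEnd ℂ (χ' t') ∂S.μT'‖ ∂S.μT :=
          Finset.sum_le_sum fun o _ => norm_integral_le_integral_norm _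
      _ = ∫ t in S.DT, ∑ o ∈ s,
            ‖∫ t' in S.DT', S.partialKernel o.1 f t t' * χ t * starRingEnd ℂ (χ' t') ∂S.μT'‖ ∂S.μT :=
          (integral_finsetSum _ fun o _ => (hint o.1).norm).symm
      _ ≤ M * S.μT'.real S.DT' * S.μT.real S.DT := by
          refine (Real.le_norm_self _).trans (norm_setIntegral_le_of_norm_le_const (measure_DT_lt_top S)
            fun t ht => ?_)
          rw [Real.norm_of_nonneg (Finset.sum_nonneg fun o _ => norm_nonneg _)]
          have hintT' : ∀ o : S.Orbit, Integrable
              (fun t' : S.T' => S.partialKernel o f t t' * χ t * starRingEnd ℂ (χ' t')) (S.μT'.restrict S.DT') :=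
            fun o => integrableOn_partialKernel_mul_DT' S hf hP o χ hχ'.cont hχ'.unit (subset_closure ht)
          calc ∑ o ∈ s, ‖∫ t' in S.DT', S.partialKernel o.1 f t t' * χ t * starRingEnd ℂ (χ' t') ∂S.μT'‖
              ≤ ∑ o ∈ s, ∫ t' in S.DT', ‖S.partialKernel o.1 f t t' * χ t * starRingEnd ℂ (χ' t')‖ ∂S.μT' :=
                Finset.sum_le_sum fun o _ => norm_integral_le_integral_norm _
            _ = ∫ t' in S.DT', ∑ o ∈ s, ‖S.partialKernel o.1 f t t' * χ t * starRingEnd ℂ (χ' t')‖ ∂S.μT' :=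
                (integral_finsetSum _ fun o _ => (hintT' o.1).norm).symm
            _ ≤ M * S.μT'.real S.DT' := by
                refine (Real.le_norm_self _).trans (norm_setIntegral_le_of_norm_le_const
                  (measure_DT'_lt_top S) fun t' ht' => ?_)
                rw [Real.norm_of_nonneg (Finset.sum_nonneg fun o _ => norm_nonneg _)]
                exact sum_norm_partialKernel_mul_compl_le S hP hχ.unit hχ'.unit E hM s (subset_closure ht)
                  (subset_closure ht')
  have hsum : Summable (fun o : ↑Eᶜ => ‖S.orbital χ χ' o.1 f‖) := summable_of_sum_le (fun _ => norm_nonneg _) key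
  exact ⟨hsum, (norm_tsum_le_tsum_norm hsum).trans (Real.tsum_le_of_sum_le (fun _ => norm_nonneg _) key)⟩

/-- **The geometric side split at a finite set `E` of double cosets**: `J(f) = ∑_{o ∈ E} O_o(f) + ∑'_{o ∉ E} O_o(f)`
(`rtf_geometric_L1` + `Summable.sum_add_tsum_compl`). -/
theorem J_eq_sum_add_tsum_compl {χ : S.T → ℂ} {χ' : S.T' → ℂ} (hχ : S.IsCharacter χ) (hχ' : S.IsCharacter' χ')
    {f : G → ℂ} (hf : Continuous f) (hP : L1Class.PoincareSummable S f) (E : Finset S.Orbit) :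
    S.J χ χ' f = ∑ o ∈ E, S.orbital χ χ' o f + ∑' o : ↑((E : Set S.Orbit)ᶜ), S.orbital χ χ' o.1 f := by
  obtain ⟨hsum, hJ⟩ := rtf_geometric_L1 S hχ hχ' hf hP
  rw [hJ, hsum.sum_add_tsum_compl]

/-- **`J(f)` is close to the fibre sum**: `‖J(f) − ∑_{o ∈ E} O_o(f)‖ ≤ M · μ_{T′}(D_{T′}) · μ_T(D_T)` when the Poincaré
series over the rational points outside the finite set `E` of double cosets is bounded by `M` on the closures — the
shape of the tail estimate of C-L4-TAIL with the stable fibre `E ∋ o₀` (lead (R-27)). -/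
theorem norm_J_sub_sum_le {χ : S.T → ℂ} {χ' : S.T' → ℂ} (hχ : S.IsCharacter χ) (hχ' : S.IsCharacter' χ')
    {f : G → ℂ} (hf : Continuous f) (hP : L1Class.PoincareSummable S f) (E : Finset S.Orbit) {M : ℝ}
    (hM : ∀ t ∈ closure S.DT, ∀ t' ∈ closure S.DT',
      ∑' γ : {γ : S.Gk // S.orbitOf γ ∈ (E : Set S.Orbit)ᶜ}, ‖f ((t : G)⁻¹ * γ.1 * t')‖ ≤ M) :
    ‖S.J χ χ' f - ∑ o ∈ E, S.orbital χ χ' o f‖ ≤ M * S.μT'.real S.DT' * S.μT.real S.DT := by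
  rw [J_eq_sum_add_tsum_compl S hχ hχ' hf hP E, add_sub_cancel_left]
  exact (norm_tsum_orbital_compl_le S hχ hχ' hf hP (E : Set S.Orbit) hM).2

end Fibre

end Summit.Ventures.HodgeRepro.Tier4.Line4

end
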